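import Summits.HodgeConjecture.HodgeConjecture.Theorems.EndoscopicMiddleDegreeOrthogonalEnvelopedProperlyDiscontinuousOfBricks
import Summits.HodgeConjecture.HodgeConjecture.Theorems.EndoscopicMiddleDegreeOrthogonalEnvelopedCongruenceBoundedFinite
import Summits.HodgeConjecture.HodgeConjecture.Theorems.EndoscopicMiddleDegreeOrthogonalEnvelopedArchimedeanBoundOfBricks
import Summits.HodgeConjecture.HodgeConjecture.Theorems.EndoscopicMiddleDegreeOrthogonalEnvelopedDefiniteUnitaryBounded
import Summits.HodgeConjecture.HodgeConjecture.Theorems.EndoscopicMiddleDegreeOrthogonalEnvelopedSylvesterEntryBound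
import Summits.HodgeConjecture.HodgeConjecture.Theorems.EndoscopicMiddleDegreeOrthogonalEnvelopedIndefiniteUnitaryEntryBound
import Summits.HodgeConjecture.HodgeConjecture.Theorems.EndoscopicMiddleDegreeOrthogonalEnvelopedCornerBound
import Summits.HodgeConjecture.HodgeConjecture.Theorems.EndoscopicMiddleDegreeOrthogonalEnvelopedFreeAction
import Summits.HodgeConjecture.HodgeConjecture.Theorems.EndoscopicMiddleDegreeOrthogonalEnvelopedBallTopology
import Summits.HodgeConjecture.HodgeConjecture.Theorems.EndoscopicMiddleDegreeOrthogonalEnvelopedLevelCovering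
import Summits.HodgeConjecture.HodgeConjecture.Theorems.EndoscopicMiddleDegreeOrthogonalEnvelopedFiniteIndexHeckeLevel
import Summits.HodgeConjecture.HodgeConjecture.Theorems.EndoscopicMiddleDegreeOrthogonalEnvelopedHeckeAdmissibleOfInputs

/-!
# `Γ` acts properly discontinuously on the ball; every `g ∈ U(V)(F)` is Hecke-admissible
# (G1 composition; crux `EndoscopicMiddleDegree.OrthogonalEnveloped`, stmt-HodgeConjecture-14300, lead seat c3)

Composition of seat c2's LANDED bricks (no new mathematics in this file):

* `stub_properlyDiscontinuous` (REGISTERED stub G1 of the construction S2b): for every compact ball quotient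
  datum `D`, the arithmetic group `Γ` acts properly discontinuously on the ball `𝔹` of negative lines —
  `stub_properlyDiscontinuousOfBricks` (p108067: finiteness of `Γ`-elements of bounded entries at every
  embedding + an archimedean bound on the elements moving a compact into a compact ⟹ proper discontinuity)
  fed with `stub_congruenceBoundedFinite` (p108331) and `stub_archimedeanBoundOfBricks` (p108471) ∘
  {`stub_definiteUnitaryBounded` (p108224), `stub_sylvesterEntryBound` (p108321) ∘
  `stub_indefiniteUnitaryEntryBound` (p107948), `stub_cornerBound` (p108918)}.
* `isHeckeAdmissible_of_mem_unitaryGroup`: consequently EVERY isometry `g ∈ U(V)(F)` is admissible for the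
  Hecke correspondence (`IsHeckeAdmissible`: finite index of the Hecke level + the level cover is a covering
  map) — `stub_heckeAdmissibleOfInputs` (p108657) fed with the above, `stub_freeOfProperlyDiscontinuous`
  (p107635), `stub_ballLocallyCompactT2` (p107937), `stub_finiteIndexHeckeLevel` (p108444),
  `stub_levelCoveringOfProperlyDiscontinuous` (p107526). So the junk branch `T_g = 0` of
  `heckeCorrespondenceAction` is never taken on `U(V)(F)`.

References: BMM arXiv:1306.1515 Part 2 §1.4 (neat `K`, `Γ` torsion-free, `S(Γ)` a compact manifold);
Shimura 1971 §3.1, §7.2.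
-/

noncomputable section

-- The crux-workfile namespace `Summit.<P>.<Sub>.Cruxes.…` repeats `HodgeConjecture` (single-conjunct summit).
set_option linter.dupNamespace false

namespace Summit.HodgeConjecture.HodgeConjecture.Cruxes.OrthogonalEnveloped.HeckeGraphChow

open Literature.AlgebraicGeometry.Motives (SchemeOver ComplexPoints)
open Literature.AlgebraicGeometry.ShimuraVarieties

/-- **Stub G1 (`stub_properlyDiscontinuous`, REGISTERED) — `Γ` acts properly discontinuously on the ball**
`𝔹` of negative lines of `V_{τ₁}`, for every compact ball quotient datum (composition of the landed bricks,
see the module docstring). [cite: BergeronMillsonMoeglin2016Balls, Part 2 §1.4] -/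
theorem stub_properlyDiscontinuous :
    ∀ {p : ℕ} {X : SchemeOver ℂ} (D : UnitaryBallQuotientDatum p X),
      ProperlyDiscontinuousSMul ↥D.Γ D.ball :=
  stub_properlyDiscontinuousOfBricks stub_congruenceBoundedFinite
    (stub_archimedeanBoundOfBricks stub_definiteUnitaryBounded
      (stub_sylvesterEntryBound stub_indefiniteUnitaryEntryBound) stub_cornerBound)

/-- **Every isometry `g ∈ U(V)(F)` is Hecke-admissible**: its Hecke level `N_g` has finite index in `Γ`
(`U(V)(F)` commensurates the congruence subgroup `Γ`) and `N_g \ 𝔹 → X(ℂ)` is a covering map (`Γ` free and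
properly discontinuous on the locally compact Hausdorff ball). [cite: Shimura1973, §3.1 and Ch. 7 §7.2]
[cite: BergeronMillsonMoeglin2016Balls, Part 2 §1.4] -/
theorem isHeckeAdmissible_of_mem_unitaryGroup {p : ℕ} {X : SchemeOver ℂ} (D : UnitaryBallQuotientDatum p X)
    {g : GL (Fin (p + 1)) D.E} (hg : g ∈ unitaryGroup (conjRingHom D.E) D.H) : D.IsHeckeAdmissible g :=
  stub_heckeAdmissibleOfInputs stub_properlyDiscontinuous stub_freeOfProperlyDiscontinuous
    stub_ballLocallyCompactT2 stub_finiteIndexHeckeLevel stub_levelCoveringOfProperlyDiscontinuous D g hg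

/-- `Γ` acts freely on the ball (instance form of the landed `stub_freeOfProperlyDiscontinuous`, now
unconditional). [cite: BergeronMillsonMoeglin2016Balls, Part 2 §1.4] -/
theorem isCancelSMul_ball {p : ℕ} {X : SchemeOver ℂ} (D : UnitaryBallQuotientDatum p X) :
    IsCancelSMul ↥D.Γ D.ball :=
  haveI := stub_properlyDiscontinuous D
  stub_freeOfProperlyDiscontinuous D

end Summit.HodgeConjecture.HodgeConjecture.Cruxes.OrthogonalEnveloped.HeckeGraphChow

end
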